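import Literature.NumberTheory.Transcendental.BlochWignerDerivative
import Literature.NumberTheory.Transcendental.GammaMonomialsLValue
import HarnessLib

/-!
# `Li₂` on the closed unit disc is the power series; `D` on the unit circle is Clausen's `Cl₂`
# (proofs)

Analytic groundwork for the √7 identity (`SqrtSevenLValueIdentity.lean`, Bailey–Borwein–
Broadhurst–Zudilin 2010, §5, named fact `BaileyEtAl2010_sqrt7_clausen`, whose statement is in
terms of the Clausen series `Cl₂(θ) = Σ_{n≥1} sin(nθ)/n²`), built on the tree's dilogarithm
(`BlochWignerDilogarithm.lean`: `dilog z = −∫₀¹ log(1 − zs) ds/s`,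
`blochWignerDilog z = Im (dilog z) + arg(1 − z) log ‖z‖`) and its derivative
(`BlochWignerDerivative.lean`: `hasDerivAt_dilog` for `z ≠ 0` off the cut). Theorems only:

* `hasDerivAt_dilog_integral` — `Li₂'(z) = ∫₀¹ ds/(1 − zs)` for EVERY `z ∉ [1,∞)` including
  `z = 0` (where the value is `1`); `differentiableAt_dilog`, `continuousAt_dilog`;
* `dilog_eq_tsum` — for `‖z‖ ≤ 1`, `z ≠ 1`: **`Li₂(z) = Σ_{n ≥ 1} zⁿ/n²`** (Zagier 2007, Ch. I §1:
  both sides are holomorphic on the open disc with derivative `−log(1 − z)/z` and vanish at `0`;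
  continuity up to the boundary minus `1`);
* `blochWignerDilog_exp_mul_I` — **`D(e^{iθ}) = Cl₂(θ) = Σ_{n ≥ 1} sin(nθ)/n²`** for every real
  `θ` (Zagier 2007, Ch. I §3; BBBZ 2010 §5: "`Cl₂(θ) = Im Σ_{n≥1} e^{inθ}/n²`").

## References

* D. Zagier, *The dilogarithm function*, in: Frontiers in Number Theory, Physics, and Geometry
  II, Springer 2007, Ch. I §§1, 3. [Zagier2007Dilogarithm]
* D. H. Bailey, J. M. Borwein, D. Broadhurst, W. Zudilin, Contemp. Math. 517 (2010), §5.
  [BaileyEtAl2010]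
-/

noncomputable section

open MeasureTheory intervalIntegral Complex Metric Set Filter Topology

namespace Literature.NumberTheory.Transcendental

namespace Dilog

/-! ### The derivative of `Li₂` at every point off the cut, including `0` -/

/-- **`Li₂'(z) = ∫₀¹ ds/(1 − zs)`** for every `z ∉ [1,∞)` (i.e. `1 − z ∈ slitPlane`), including
`z = 0` (differentiation under the integral sign, as in `hasDerivAt_dilog` of
`BlochWignerDerivative.lean` but without the closed form, which needs `z ≠ 0`).
[cite: Zagier2007Dilogarithm, Ch. I §1] -/
theorem hasDerivAt_dilog_integral {z : ℂ} (hz : 1 - z ∈ slitPlane) :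
    HasDerivAt dilog (∫ s in (0 : ℝ)..1, (1 - z * (s : ℂ))⁻¹) z := by
  obtain ⟨δ, hδ, C, hC⟩ := exists_ball_slit_inv_bound hz
  have key := intervalIntegral.hasDerivAt_integral_of_dominated_loc_of_deriv_le
    (𝕜 := ℂ) (μ := volume) (a := (0 : ℝ)) (b := 1)
    (F := fun (x : ℂ) (t : ℝ) => Complex.log (1 - x * (t : ℂ)) / (t : ℂ))
    (F' := fun (x : ℂ) (t : ℝ) => -(1 - x * (t : ℂ))⁻¹) (x₀ := z)
    (bound := fun _ => C) (ball_mem_nhds z hδ)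
    (Filter.Eventually.of_forall fun x => (measurable_dilogIntegrand x).aestronglyMeasurable)
    (intervalIntegrable_dilogIntegrand hz)
    ((Measurable.inv (by fun_prop)).neg.aestronglyMeasurable)
    (Filter.Eventually.of_forall fun t ht x hx => by
      rw [uIoc_of_le zero_le_one] at ht
      rw [norm_neg]
      exact (hC x hx t ⟨ht.1.le, ht.2⟩).2)
    intervalIntegrable_const
    (Filter.Eventually.of_forall fun t ht x hx => by
      rw [uIoc_of_le zero_le_one] at ht
      exact hasDerivAt_clog_one_sub_mul_div ht.1.ne' (hC x hx t ⟨ht.1.le, ht.2⟩).1)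
  have h2 := key.2.neg
  rw [intervalIntegral.integral_neg, neg_neg] at h2
  have hfun :
      (-fun x : ℂ => ∫ t in (0 : ℝ)..1, Complex.log (1 - x * (t : ℂ)) / (t : ℂ)) = dilog := by
    funext x; simp only [Pi.neg_apply, dilog]
  rw [hfun] at h2
  exact h2

/-- `Li₂` is complex-differentiable at every `z ∉ [1,∞)`. [cite: Zagier2007Dilogarithm, Ch. I §1] -/
theorem differentiableAt_dilog {z : ℂ} (hz : 1 - z ∈ slitPlane) : DifferentiableAt ℂ dilog z :=
  (hasDerivAt_dilog_integral hz).differentiableAt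

/-- `Li₂` is continuous at every `z ∉ [1,∞)`. [cite: Zagier2007Dilogarithm, Ch. I §1] -/
theorem continuousAt_dilog {z : ℂ} (hz : 1 - z ∈ slitPlane) : ContinuousAt dilog z :=
  (differentiableAt_dilog hz).continuousAt

/-- The domain `ℂ ∖ [1,∞) = {z | 1 − z ∈ slitPlane}` is open. [folklore] -/
theorem isOpen_dilogDomain : IsOpen {z : ℂ | 1 - z ∈ slitPlane} :=
  isOpen_slitPlane.preimage (by fun_prop)

/-- `Li₂` is analytic at every `z ∉ [1,∞)`. [cite: Zagier2007Dilogarithm, Ch. I §1] -/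
theorem analyticAt_dilog {z : ℂ} (hz : 1 - z ∈ slitPlane) : AnalyticAt ℂ dilog z := by
  have hd : DifferentiableOn ℂ dilog {z : ℂ | 1 - z ∈ slitPlane} :=
    fun w hw => (differentiableAt_dilog hw).differentiableWithinAt
  exact (hd.analyticOnNhd isOpen_dilogDomain) z hz

/-! ### The power series `Σ zⁿ/n²` on the closed unit disc -/

/-- Norm of the general term: `‖zⁿ/n²‖ ≤ 1/n²` for `‖z‖ ≤ 1`. [folklore] -/
theorem norm_pow_div_sq_le {z : ℂ} (hz : ‖z‖ ≤ 1) (n : ℕ) :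
    ‖z ^ n / (n : ℂ) ^ 2‖ ≤ 1 / (n : ℝ) ^ 2 := by
  rw [norm_div, norm_pow, norm_pow, Complex.norm_natCast]
  rcases Nat.eq_zero_or_pos n with rfl | hn
  · simp
  · gcongr
    exact pow_le_one₀ (norm_nonneg z) hz

/-- The series `Σ zⁿ/n²` converges (absolutely) on the closed unit disc. [folklore] -/
theorem summable_pow_div_sq {z : ℂ} (hz : ‖z‖ ≤ 1) : Summable fun n : ℕ => z ^ n / (n : ℂ) ^ 2 :=
  Summable.of_norm_bounded (Real.summable_one_div_nat_pow.mpr one_lt_two) (norm_pow_div_sq_le hz)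

/-- `Σ zⁿ/n²` is continuous on the closed unit disc. [folklore] -/
theorem continuousOn_tsum_pow_div_sq :
    ContinuousOn (fun z : ℂ => ∑' n : ℕ, z ^ n / (n : ℂ) ^ 2) (closedBall (0 : ℂ) 1) := by
  refine continuousOn_tsum (fun n => ?_) (Real.summable_one_div_nat_pow.mpr one_lt_two)
    (fun n z hz => norm_pow_div_sq_le (by simpa using hz) n)
  fun_prop

/-- Termwise derivative on the open disc: for `‖z‖ < 1`,
`(Σ wⁿ/n²)'(z) = Σ n zⁿ⁻¹/n²`. [folklore] -/
theorem hasDerivAt_tsum_pow_div_sq {z : ℂ} (hz : ‖z‖ < 1) :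
    HasDerivAt (fun w : ℂ => ∑' n : ℕ, w ^ n / (n : ℂ) ^ 2)
      (∑' n : ℕ, (n : ℂ) * z ^ (n - 1) / (n : ℂ) ^ 2) z := by
  set r : ℝ := (‖z‖ + 1) / 2 with hr
  have hr0 : 0 < r := by rw [hr]; positivity
  have hr1 : r < 1 := by rw [hr]; linarith
  have hzr : ‖z‖ < r := by rw [hr]; linarith
  have hu : Summable fun n : ℕ => r ^ n / r := (summable_geometric_of_lt_one hr0.le hr1).div_const r
  refine hasDerivAt_tsum_of_isPreconnected (g := fun (n : ℕ) (w : ℂ) => w ^ n / (n : ℂ) ^ 2)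
    (g' := fun (n : ℕ) (w : ℂ) => (n : ℂ) * w ^ (n - 1) / (n : ℂ) ^ 2) (t := ball (0 : ℂ) r)
    (y₀ := 0) hu isOpen_ball (convex_ball 0 r).isPreconnected ?_ ?_ (mem_ball_self hr0) ?_
    (by simpa using hzr)
  · intro n w _
    exact (hasDerivAt_pow n w).div_const _
  · intro n w hw
    rw [mem_ball_zero_iff] at hw
    rcases Nat.eq_zero_or_pos n with rfl | hn
    · simp only [Nat.cast_zero, zero_mul, zero_div, norm_zero, pow_zero]
      exact div_nonneg zero_le_one hr0.le
    · rw [norm_div, norm_mul, norm_pow, norm_pow, Complex.norm_natCast]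
      have h1 : (n : ℝ) * ‖w‖ ^ (n - 1) / (n : ℝ) ^ 2 = ‖w‖ ^ (n - 1) / n := by
        field_simp
      rw [h1]
      have h2 : ‖w‖ ^ (n - 1) / n ≤ ‖w‖ ^ (n - 1) := div_le_self (by positivity) (by exact_mod_cast hn)
      have h3 : ‖w‖ ^ (n - 1) ≤ r ^ (n - 1) := by gcongr
      have h4 : r ^ (n - 1) = r ^ n / r := by
        rw [eq_div_iff hr0.ne', ← pow_succ, Nat.sub_add_cancel hn]
      linarith
  · exact summable_pow_div_sq (by simp)

/-- The termwise derivative in closed form: for `0 < ‖z‖ < 1`, `Σ n zⁿ⁻¹/n² = −log(1 − z)/z`.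
[folklore] -/
theorem tsum_deriv_term_eq {z : ℂ} (hz : ‖z‖ < 1) (hz0 : z ≠ 0) :
    ∑' n : ℕ, (n : ℂ) * z ^ (n - 1) / (n : ℂ) ^ 2 = -Complex.log (1 - z) / z := by
  have h := (Complex.hasSum_taylorSeries_neg_log hz).div_const z
  rw [← h.tsum_eq]
  refine tsum_congr fun n => ?_
  rcases Nat.eq_zero_or_pos n with rfl | hn
  · simp
  · have hn' : (n : ℂ) ≠ 0 := by exact_mod_cast hn.ne'
    rw [show z ^ n = z ^ (n - 1) * z by rw [← pow_succ, Nat.sub_add_cancel hn]]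
    field_simp

/-- The termwise derivative at `0` is `1`. [folklore] -/
theorem tsum_deriv_term_zero :
    ∑' n : ℕ, (n : ℂ) * (0 : ℂ) ^ (n - 1) / (n : ℂ) ^ 2 = 1 := by
  rw [tsum_eq_single 1]
  · simp
  · intro n hn
    rcases Nat.eq_zero_or_pos n with rfl | hpos
    · simp
    · have : n - 1 ≠ 0 := by omega
      simp [this]

/-- For `‖z‖ < 1`, `1 − z` lies in the slit plane. [folklore] -/
theorem one_sub_mem_slitPlane_of_norm_lt_one {z : ℂ} (hz : ‖z‖ < 1) : 1 - z ∈ slitPlane := by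
  rw [mem_slitPlane_iff]; left
  have := (abs_re_le_norm z).trans_lt hz
  simp only [sub_re, one_re]
  linarith [le_abs_self z.re]

/-- **`Li₂(z) = Σ_{n≥1} zⁿ/n²` on the open unit disc.** [cite: Zagier2007Dilogarithm, Ch. I §1] -/
theorem dilog_eq_tsum_of_norm_lt_one {z : ℂ} (hz : ‖z‖ < 1) :
    dilog z = ∑' n : ℕ, z ^ n / (n : ℂ) ^ 2 := by
  have hdiff1 : DifferentiableOn ℂ dilog (ball (0 : ℂ) 1) := fun w hw =>
    (differentiableAt_dilog (one_sub_mem_slitPlane_of_norm_lt_one (by simpa using hw))).differentiableWithinAt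
  have hdiff2 : DifferentiableOn ℂ (fun w : ℂ => ∑' n : ℕ, w ^ n / (n : ℂ) ^ 2) (ball (0 : ℂ) 1) :=
    fun w hw => (hasDerivAt_tsum_pow_div_sq (by simpa using hw)).differentiableAt.differentiableWithinAt
  have hderiv : EqOn (deriv dilog) (deriv fun w : ℂ => ∑' n : ℕ, w ^ n / (n : ℂ) ^ 2) (ball (0 : ℂ) 1) := by
    intro w hw
    have hw' : ‖w‖ < 1 := by simpa using hw
    rw [(hasDerivAt_dilog_integral (one_sub_mem_slitPlane_of_norm_lt_one hw')).deriv,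
      (hasDerivAt_tsum_pow_div_sq hw').deriv]
    by_cases hw0 : w = 0
    · subst hw0
      rw [tsum_deriv_term_zero]
      simp
    · rw [integral_inv_one_sub_mul (one_sub_mem_slitPlane_of_norm_lt_one hw') hw0,
        tsum_deriv_term_eq hw' hw0]
  have h0 : dilog 0 = ∑' n : ℕ, (0 : ℂ) ^ n / (n : ℂ) ^ 2 := by
    rw [dilog_zero, tsum_eq_single 0]
    · simp
    · intro n hn; simp [hn]
  exact isOpen_ball.eqOn_of_deriv_eq (convex_ball (0 : ℂ) 1).isPreconnected hdiff1 hdiff2 hderiv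
    (mem_ball_self one_pos) h0 (by simpa using hz)

/-- **`Li₂(z) = Σ_{n≥1} zⁿ/n²` on the closed unit disc minus `1`** (continuity up to the boundary).
[cite: Zagier2007Dilogarithm, Ch. I §1] -/
theorem dilog_eq_tsum {z : ℂ} (hz : ‖z‖ ≤ 1) (hz1 : z ≠ 1) :
    dilog z = ∑' n : ℕ, z ^ n / (n : ℂ) ^ 2 := by
  have heq : EqOn dilog (fun w : ℂ => ∑' n : ℕ, w ^ n / (n : ℂ) ^ 2) (ball (0 : ℂ) 1) :=
    fun w hw => dilog_eq_tsum_of_norm_lt_one (by simpa using hw)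
  have ht : EqOn dilog (fun w : ℂ => ∑' n : ℕ, w ^ n / (n : ℂ) ^ 2) (closedBall (0 : ℂ) 1 \ {1}) := by
    refine heq.of_subset_closure ?_ ?_ ?_ ?_
    · intro w hw
      refine (continuousAt_dilog (KoblitzOgus.one_sub_mem_slitPlane ?_ hw.2)).continuousWithinAt
      simpa using hw.1
    · exact continuousOn_tsum_pow_div_sq.mono sdiff_subset
    · intro w hw
      refine ⟨ball_subset_closedBall hw, ?_⟩
      rintro rfl
      simp at hw
    · rw [closure_ball (0 : ℂ) one_ne_zero]
      exact sdiff_subset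
  exact ht ⟨by simpa using hz, hz1⟩

/-! ### `D` on the unit circle -/

/-- **`D(e^{iθ}) = Cl₂(θ) = Σ_{n≥1} sin(nθ)/n²`** for every real `θ` (with `n = 0` contributing
`0`). [cite: Zagier2007Dilogarithm, Ch. I §3] -/
theorem blochWignerDilog_exp_mul_I (θ : ℝ) :
    blochWignerDilog (Complex.exp (θ * I)) = ∑' n : ℕ, Real.sin (n * θ) / (n : ℝ) ^ 2 := by
  have hnorm : ‖Complex.exp (θ * I)‖ = 1 := by simp
  by_cases h1 : Complex.exp (θ * I) = 1
  · -- `θ ∈ 2πℤ`: both sides vanish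
    rw [h1]
    obtain ⟨k, hk⟩ := Complex.exp_eq_one_iff.1 h1
    have hθ : θ = k * (2 * Real.pi) := by
      have h2 : (θ : ℂ) * I = ((k * (2 * Real.pi) : ℝ) : ℂ) * I := by rw [hk]; push_cast; ring
      exact_mod_cast mul_right_cancel₀ I_ne_zero h2
    have hsin : ∀ n : ℕ, Real.sin (n * θ) = 0 := by
      intro n
      rw [hθ, show (n : ℝ) * (k * (2 * Real.pi)) = ((2 * n * k : ℤ) : ℝ) * Real.pi by push_cast; ring]
      exact Real.sin_int_mul_pi _
    have hD := blochWignerDilog_ofReal_of_le_one (le_refl (1 : ℝ))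
    rw [Complex.ofReal_one] at hD
    rw [hD]
    simp [hsin]
  · have hs := summable_pow_div_sq hnorm.le
    rw [blochWignerDilog_def, dilog_eq_tsum hnorm.le h1, hnorm, Real.log_one, mul_zero, add_zero,
      Complex.im_tsum hs]
    refine tsum_congr fun n => ?_
    rw [← Complex.exp_nat_mul, show (n : ℂ) * (θ * I) = ((n * θ : ℝ) : ℂ) * I by push_cast; ring,
      show ((n : ℂ)) ^ 2 = ((n ^ 2 : ℕ) : ℂ) by push_cast; ring, Complex.div_natCast_im,
      Complex.exp_ofReal_mul_I_im]
    push_cast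
    ring


end Dilog

end Literature.NumberTheory.Transcendental
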